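import Literature.NumberTheory.Automorphic.OrbitalIntegralHaarAutomorphismTransport   -- ★ `IsCanonical.classOrbitalIntegral_comp_continuousMulEquiv_eq` idiom; brings ★ `CompactCoreLevelPoint` (`IsCanonical.atPoint_eq_quotientMeasure`), ★ `OrbitalMeasureCanonicalAtPoint` (`classOrbitalIntegral_mk_eq_orbitalIntegral'`, `apply_out_conjClassesMk_of_forall_conj`)
import Literature.NumberTheory.Rogawski1990.LocalTransfer                            -- ★ `stableOrbitalIntegralRel`
import HarnessLib

/-!
# Central translation of canonical orbital integrals: `Φ(⟦z·γ⟧, F) = Φ(⟦γ⟧, F(z·))` for `z` in the centre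

Rogawski [Rogawski1990, §4.3 (4.3.1) p. 43; §4.9 p. 55] normalises the orbital integrals `Φ(γ, f) = ∫_{G_γ∖G} f(g⁻¹γg) dg∕dt` with
COMPATIBLE measures (`dt` canonical on the centraliser: mass one on its compact core, ★ `OrbitalMeasureFamily.IsCanonical`).  For a CENTRAL
element `z` one has `G_{zγ} = G_γ` and `g⁻¹(zγ)g = z·(g⁻¹γg)`, so with this normalisation
**`Φ(⟦z·γ⟧, F) = Φ(⟦γ⟧, x ↦ F(z·x))`** — the orbital side of the CENTRAL-CHARACTER RULE («`Δ_{G∕H}(zγ) = μ(z)Δ_{G∕H}(γ)`»,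
★ `finExplicitDelta_central_mul` on the factor side) used to move a transfer identity from one central element to another, in particular to
reduce «local transfer at a central element» to «local transfer AT THE IDENTITY» ([LanglandsShelstad1990Descent, (2.1.2)]).

Topic `NumberTheory/Automorphic`; namespace `Literature.NumberTheory.Automorphic`.  THEOREMS ONLY (generic locally compact group `G`; no definition,
no instance, no notation, no named fact, no `sorry`).  Cell `pub/hodgecm-mathlib` (D-0151), crux H413 = stmt-HodgeConjecture-24833, line «N6nsGerm»
(print residue `stub_N6nsS3` = local `Δ‴`-transfer at a CENTRAL `εH`; A-p13 (g31) cost census 37220e2f §6 (1) «C0 orbital side»; LEAD T8-160); hand A-p12 (g19).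

* §1 `centralizer_singleton_central_mul_eq` (`G_{zγ} = G_γ`), `isConj_central_mul_iff` (`zγ ∼ zδ ↔ γ ∼ δ`), the class map `c ↦ ⟦z · out c⟧` and its
  inverse (`conjClassesMk_central_mul_out_…`).
* §2 transport along EQUAL centralising subgroups (private plumbing by `subst`): the quotient measure and the orbital integrand do not see which
  name the subgroup carries.
* §3 **`IsCanonical.classOrbitalIntegral_mk_central_mul_eq`** — `Φ(⟦z·γ⟧, F; m) = Φ(⟦γ⟧, F(z·); m)` for `m` canonical for a class function `P` with
  `P γ`, `P (zγ)`; and **`stableOrbitalIntegralRel_central_mul_eq`** — the same for `Φ^st` relative to any «stable conjugacy» `st` compatible with `z`.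
HONEST LABEL: HC_CM is proved only modulo the printed citations (2 remaining named inputs hLiu418, h413) until rung 0 closes; this file is measure-theoretic
bookkeeping, count-neutral.

## References
* [Rogawski1990] J. D. Rogawski, *Automorphic Representations of Unitary Groups in Three Variables*, Ann. of Math. Stud. 123 (1990): §4.3 (4.3.1) p. 43;
  §4.9 p. 55 («`Δ_{G∕H}(zγ) = μ(z)Δ_{G∕H}(γ)`»).
* [LanglandsShelstad1990Descent] R. P. Langlands, D. Shelstad, *Descent for transfer factors*, The Grothendieck Festschrift II (1990): §2.1 (2.1.2).
* [DeitmarEchterhoff2014] A. Deitmar, S. Echterhoff, *Principles of Harmonic Analysis*, 2nd ed. (2014): Thm. 1.5.3.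
* [BourbakiAlgebraI1989] N. Bourbaki, *Algebra I, Chapters 1–3* (1989): Ch. I §5 no. 4 (conjugate elements, centre, centralisers).
-/

set_option autoImplicit false

noncomputable section

open MeasureTheory Measure Topology Filter Set
open scoped ENNReal NNReal

namespace Literature.NumberTheory.Automorphic

open Literature.MeasureTheory.Group Literature.NumberTheory.Rogawski1990

/-! ## §1 Centre, centralisers and conjugacy classes -/

section Algebra

variable {G : Type*} [Group G]

/-- **`G_{zγ} = G_γ` for central `z`.** [cite: BourbakiAlgebraI1989, Ch. I §5 no. 4] -/
theorem centralizer_singleton_central_mul_eq {z : G} (hz : z ∈ Subgroup.center G) (γ : G) :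
    Subgroup.centralizer ({z * γ} : Set G) = Subgroup.centralizer ({γ} : Set G) := by
  ext g
  simp only [Subgroup.mem_centralizer_singleton_iff]
  have hzg : g * z = z * g := Subgroup.mem_center_iff.1 hz g
  constructor
  · intro h
    have h' : z * (g * γ) = z * (γ * g) := by
      calc z * (g * γ) = (g * z) * γ := by rw [hzg, mul_assoc]
        _ = g * (z * γ) := by rw [mul_assoc]
        _ = z * γ * g := h
        _ = z * (γ * g) := mul_assoc _ _ _
    exact mul_left_cancel h'
  · intro h
    calc g * (z * γ) = (g * z) * γ := (mul_assoc _ _ _).symm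
      _ = z * (g * γ) := by rw [hzg, mul_assoc]
      _ = z * (γ * g) := by rw [h]
      _ = z * γ * g := (mul_assoc _ _ _).symm

/-- `y (zγ) y⁻¹ = z (y γ y⁻¹)` for central `z`. [cite: BourbakiAlgebraI1989, Ch. I §5 no. 4] -/
theorem conj_central_mul_eq {z : G} (hz : z ∈ Subgroup.center G) (γ y : G) : y * (z * γ) * y⁻¹ = z * (y * γ * y⁻¹) := by
  have hzy : y * z = z * y := Subgroup.mem_center_iff.1 hz y
  calc y * (z * γ) * y⁻¹ = (y * z) * γ * y⁻¹ := by rw [← mul_assoc]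
    _ = z * y * γ * y⁻¹ := by rw [hzy]
    _ = z * (y * γ * y⁻¹) := by simp only [mul_assoc]

/-- **`zγ ∼ zδ ↔ γ ∼ δ`** for central `z`. [cite: BourbakiAlgebraI1989, Ch. I §5 no. 4] -/
theorem isConj_central_mul_iff {z : G} (hz : z ∈ Subgroup.center G) (γ δ : G) : IsConj (z * γ) (z * δ) ↔ IsConj γ δ := by
  constructor
  · intro h
    obtain ⟨c, hc⟩ := isConj_iff.1 h
    rw [conj_central_mul_eq hz] at hc
    exact isConj_iff.2 ⟨c, mul_left_cancel hc⟩
  · intro h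
    obtain ⟨c, hc⟩ := isConj_iff.1 h
    exact isConj_iff.2 ⟨c, by rw [conj_central_mul_eq hz, hc]⟩

/-- `⟦out c⟧ = c`. [cite: BourbakiAlgebraI1989, Ch. I §5 no. 4] -/
theorem conjClassesMk_out_eq (c : ConjClasses G) : ConjClasses.mk (Quotient.out c) = c := by
  rw [← ConjClasses.quotient_mk_eq_mk, Quotient.out_eq]

/-- `out ⟦γ⟧ ∼ γ`. [cite: BourbakiAlgebraI1989, Ch. I §5 no. 4] -/
theorem isConj_out_conjClassesMk (γ : G) : IsConj (Quotient.out (ConjClasses.mk γ)) γ :=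
  ConjClasses.mk_eq_mk_iff_isConj.1 (conjClassesMk_out_eq (ConjClasses.mk γ))

/-- **The class map `c ↦ ⟦z · out c⟧` is inverted by `c ↦ ⟦z⁻¹ · out c⟧`** (central `z`). [cite: BourbakiAlgebraI1989, Ch. I §5 no. 4] -/
theorem conjClassesMk_central_mul_out_inv_mul_out {z : G} (hz : z ∈ Subgroup.center G) (c : ConjClasses G) :
    ConjClasses.mk (z * Quotient.out (ConjClasses.mk (z⁻¹ * Quotient.out c))) = c := by
  have hzi : z⁻¹ ∈ Subgroup.center G := inv_mem hz
  have h1 : IsConj (Quotient.out (ConjClasses.mk (z⁻¹ * Quotient.out c))) (z⁻¹ * Quotient.out c) := isConj_out_conjClassesMk _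
  have h2 : IsConj (z * Quotient.out (ConjClasses.mk (z⁻¹ * Quotient.out c))) (z * (z⁻¹ * Quotient.out c)) := (isConj_central_mul_iff hz _ _).2 h1
  rw [mul_inv_cancel_left] at h2
  rw [ConjClasses.mk_eq_mk_iff_isConj.2 h2, conjClassesMk_out_eq]

/-- The same with `z` and `z⁻¹` exchanged. [cite: BourbakiAlgebraI1989, Ch. I §5 no. 4] -/
theorem conjClassesMk_central_inv_mul_out_mul_out {z : G} (hz : z ∈ Subgroup.center G) (c : ConjClasses G) :
    ConjClasses.mk (z⁻¹ * Quotient.out (ConjClasses.mk (z * Quotient.out c))) = c := by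
  have h := conjClassesMk_central_mul_out_inv_mul_out (inv_mem hz : z⁻¹ ∈ Subgroup.center G) c
  rwa [inv_inv] at h

/-- `⟦z · out ⟦γ⟧⟧ = ⟦z · γ⟧` (central `z`). [cite: BourbakiAlgebraI1989, Ch. I §5 no. 4] -/
theorem conjClassesMk_central_mul_out_mk {z : G} (hz : z ∈ Subgroup.center G) (γ : G) :
    ConjClasses.mk (z * Quotient.out (ConjClasses.mk γ)) = ConjClasses.mk (z * γ) :=
  ConjClasses.mk_eq_mk_iff_isConj.2 ((isConj_central_mul_iff hz _ _).2 (isConj_out_conjClassesMk γ))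

/-- **The class bijection `c ↦ ⟦z · out c⟧` of `ConjClasses G`** induced by a central `z` (as an `Equiv`; inverse `c ↦ ⟦z⁻¹ · out c⟧`). [cite: BourbakiAlgebraI1989, Ch. I §5 no. 4] -/
theorem bijective_conjClassesMk_central_mul_out {z : G} (hz : z ∈ Subgroup.center G) :
    Function.Bijective fun c : ConjClasses G => ConjClasses.mk (z * Quotient.out c) :=
  Function.bijective_iff_has_inverse.2 ⟨fun c => ConjClasses.mk (z⁻¹ * Quotient.out c),
    fun c => conjClassesMk_central_inv_mul_out_mul_out hz c, fun c => conjClassesMk_central_mul_out_inv_mul_out hz c⟩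

end Algebra

/-! ## §2 Transport along equal centralising subgroups -/

section Transport

variable {G : Type*} [Group G] [TopologicalSpace G] [IsTopologicalGroup G] [LocallyCompactSpace G]
  [SecondCountableTopology G] [T2Space G] [MeasurableSpace G] [BorelSpace G]

/-- (Plumbing.)  For EQUAL closed subgroups `Z₁ = Z₂` centralising `γ`, a normalising measure `t₁` on `Z₁` yields one on `Z₂` with the same
quotient orbital integral of every integrand — the two quotients `G ⧸ Z₁`, `G ⧸ Z₂` may carry syntactically different (Borel) measurable structures.
Proof by `subst`. [folklore] -/
private theorem exists_integral_descConj_quotientMeasure_eq_of_eq (ν : Measure G) [ν.IsHaarMeasure] [ν.IsMulRightInvariant]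
    {Z₁ Z₂ : Subgroup G} (h : Z₁ = Z₂)
    [i₁ : MeasurableSpace (G ⧸ Z₁)] [b₁ : BorelSpace (G ⧸ Z₁)] [i₂ : MeasurableSpace (G ⧸ Z₂)] [b₂ : BorelSpace (G ⧸ Z₂)]
    (γ : G) (h₁ : ∀ g ∈ Z₁, g * γ = γ * g) (h₂ : ∀ g ∈ Z₂, g * γ = γ * g) (hZ₁ : IsClosed (Z₁ : Set G)) (hZ₂ : IsClosed (Z₂ : Set G))
    (t₁ : Measure Z₁) [t₁.IsHaarMeasure] [t₁.IsInvInvariant] (ht₁ : t₁ (compactCore Z₁) = 1)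
    {E : Type*} [NormedAddCommGroup E] [NormedSpace ℝ E] (F : G → E) :
    ∃ t₂ : Measure Z₂, ∃ (_ : t₂.IsHaarMeasure) (_ : t₂.IsInvInvariant), t₂ (compactCore Z₂) = 1 ∧
      ∫ x, descConj γ Z₂ h₂ F x ∂(quotientMeasure Z₂ t₂ hZ₂ ν) = ∫ x, descConj γ Z₁ h₁ F x ∂(quotientMeasure Z₁ t₁ hZ₁ ν) := by
  subst h
  have hi : i₂ = i₁ := b₂.measurable_eq.trans b₁.measurable_eq.symm
  subst hi
  exact ⟨t₁, ‹_›, ‹_›, ht₁, rfl⟩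

end Transport

/-! ## §3 Central translation of canonical class orbital integrals and of `Φ^st` -/

section Central

variable {G : Type*} [Group G] [TopologicalSpace G] [IsTopologicalGroup G] [LocallyCompactSpace G]
  [SecondCountableTopology G] [T2Space G] [MeasurableSpace G] [BorelSpace G]
  [∀ γ : G, MeasurableSpace (G ⧸ Subgroup.centralizer ({γ} : Set G))]
  [∀ γ : G, BorelSpace (G ⧸ Subgroup.centralizer ({γ} : Set G))]

/-- **CENTRAL TRANSLATION OF CANONICAL CLASS ORBITAL INTEGRALS.**  For `m` canonical for `(P, ν)` with `P` a class function, `z ∈ Z(G)`, and `γ` with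
`P γ` and `P (z·γ)`: **`Φ(⟦z·γ⟧, F; m) = Φ(⟦γ⟧, x ↦ F(z·x); m)`** — both are the orbital integral against `ν ∕ t` with `t` THE canonical measure on
`G_{zγ} = G_γ` (★ `IsCanonical.classOrbitalIntegral_mk_eq_orbitalIntegral'`), and `y(zγ)y⁻¹ = z·(yγy⁻¹)`.  The orbital side of Rogawski's central-character
rule `Δ_{G∕H}(zγ) = μ(z)Δ_{G∕H}(γ)`. [cite: Rogawski1990, §4.3 (4.3.1) p. 43; §4.9 p. 55] [cite: DeitmarEchterhoff2014, Thm. 1.5.3] -/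
theorem OrbitalMeasureFamily.IsCanonical.classOrbitalIntegral_mk_central_mul_eq
    {P : G → Prop} (hP : ∀ g x : G, P g → P (x * g * x⁻¹)) {ν : Measure G} [ν.IsHaarMeasure] [ν.IsMulRightInvariant]
    {m : OrbitalMeasureFamily G} (hm : m.IsCanonical P ν) {z : G} (hz : z ∈ Subgroup.center G)
    {γ : G} (hγ : P γ) (hzγ : P (z * γ)) {E : Type*} [NormedAddCommGroup E] [NormedSpace ℝ E] (F : G → E) :
    classOrbitalIntegral m F (ConjClasses.mk (z * γ)) = classOrbitalIntegral m (fun x => F (z * x)) (ConjClasses.mk γ) := by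
  -- the canonical normalising measure at `γ`
  obtain ⟨t, ht, hti, ht1, -⟩ := hm.atPoint_eq_quotientMeasure γ (apply_out_conjClassesMk_of_forall_conj hP hγ)
  -- transported to the (equal) centraliser of `zγ`
  obtain ⟨t', ht', hti', ht'1, hint⟩ := exists_integral_descConj_quotientMeasure_eq_of_eq ν
    (centralizer_singleton_central_mul_eq hz γ).symm (z * γ)
    (fun g hg => by
      have hg' : g ∈ Subgroup.centralizer ({z * γ} : Set G) := by rwa [centralizer_singleton_central_mul_eq hz γ]
      exact Subgroup.mem_centralizer_singleton_iff.1 hg')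
    (fun g hg => Subgroup.mem_centralizer_singleton_iff.1 hg)
    (isClosed_coe_centralizer_singleton γ) (isClosed_coe_centralizer_singleton (z * γ)) t ht1 F
  rw [hm.classOrbitalIntegral_mk_eq_orbitalIntegral' hP hzγ t' ht'1 F, hm.classOrbitalIntegral_mk_eq_orbitalIntegral' hP hγ t ht1 (fun x => F (z * x)),
    orbitalIntegral_eq_integral_descConj, orbitalIntegral_eq_integral_descConj, hint]
  -- the integrands agree: `y (zγ) y⁻¹ = z (y γ y⁻¹)`
  congr 1
  funext y
  induction y using QuotientGroup.induction_on with
  | H g => rw [descConj_mk, descConj_mk, conj_central_mul_eq hz]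

/-- **CENTRAL TRANSLATION OF `Φ^st`.**  For `m` canonical for `(P, ν)`, `P` a class function stable under `st` (`P a → st a b → P b`) and under `z·`,
`st` a class function in its second argument with `st (za) (zb) ↔ st a b`, `z` central and `P γ`:
**`Φ^st(z·γ, F; m) = Φ^st(γ, x ↦ F(z·x); m)`** (★ `stableOrbitalIntegralRel`: the `finsum` over the classes `c` with `st γ (out c)`, re-indexed along
`c ↦ ⟦z · out c⟧`). [cite: Rogawski1990, §4.1 (4.1.1) p. 39; §4.9 p. 55] -/
theorem OrbitalMeasureFamily.IsCanonical.stableOrbitalIntegralRel_central_mul_eq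
    {P : G → Prop} (hP : ∀ g x : G, P g → P (x * g * x⁻¹)) {ν : Measure G} [ν.IsHaarMeasure] [ν.IsMulRightInvariant]
    {m : OrbitalMeasureFamily G} (hm : m.IsCanonical P ν) {z : G} (hz : z ∈ Subgroup.center G)
    (st : G → G → Prop) (hst_conj : ∀ a b x : G, st a (x * b * x⁻¹) ↔ st a b) (hst_z : ∀ a b : G, st (z * a) (z * b) ↔ st a b)
    (hP_st : ∀ a b : G, P a → st a b → P b) (hP_z : ∀ a : G, P a → P (z * a))
    {γ : G} (hγ : P γ) (F : G → ℂ) :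
    stableOrbitalIntegralRel st m F (z * γ) = stableOrbitalIntegralRel st m (fun x => F (z * x)) γ := by
  rw [stableOrbitalIntegralRel_def, stableOrbitalIntegralRel_def]
  -- re-index the right-hand finsum along the class bijection `e : c ↦ ⟦z · out c⟧`
  symm
  refine finsum_mem_eq_of_bijOn (fun c : ConjClasses G => ConjClasses.mk (z * Quotient.out c)) ⟨?_, ?_, ?_⟩ ?_
  · -- maps `{c | st γ (out c)}` into `{c | st (zγ) (out c)}`
    intro c hc
    simp only [Set.mem_setOf_eq] at hc ⊢
    obtain ⟨x, hx⟩ := isConj_iff.1 (isConj_out_conjClassesMk (z * Quotient.out c)).symm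
    rw [← hx, hst_conj, hst_z]
    exact hc
  · exact (bijective_conjClassesMk_central_mul_out hz).injective.injOn
  · -- surjective onto
    intro c hc
    simp only [Set.mem_setOf_eq] at hc
    refine ⟨ConjClasses.mk (z⁻¹ * Quotient.out c), ?_, conjClassesMk_central_mul_out_inv_mul_out hz c⟩
    simp only [Set.mem_setOf_eq]
    obtain ⟨x, hx⟩ := isConj_iff.1 (isConj_out_conjClassesMk (z⁻¹ * Quotient.out c)).symm
    rw [← hx, hst_conj, ← hst_z, mul_inv_cancel_left]
    exact hc
  · -- the summands agree
    intro c hc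
    simp only [Set.mem_setOf_eq] at hc
    have hPc : P (Quotient.out c) := hP_st _ _ hγ hc
    rw [hm.classOrbitalIntegral_mk_central_mul_eq hP hz hPc (hP_z _ hPc) F, conjClassesMk_out_eq]

end Central

end Literature.NumberTheory.Automorphic

end
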